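import Literature.AlgebraicGeometry.Frobenioids.IrreducibleMorphisms
import Literature.AlgebraicGeometry.Frobenioids.FSMIMorphisms
import Literature.AlgebraicGeometry.Frobenioids.ElementaryIsomorphisms
import Mathlib.NumberTheory.ArithmeticFunction.Misc
import HarnessLib

/-!
# Frobenioids I, Proposition 1.14 (Irreducible Morphisms), part (iii): bounded FSMI-chains

Mochizuki, *The geometry of Frobenioids I: the general theory*, Kyushu J. Math. **62** (2008)
293–400, §1, Proposition 1.14 (iii) and its proof, kurims text pp. 41–43
[cite: MochizukiFrdI2008, Prop. 1.14]. Standing data: `Φ` a divisorial monoid on a connected,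
totally epimorphic category `D`; `C → F_Φ` a Frobenioid (`hF`) of isotropic type (`hist`); `D` of
FSMFF-type (`hD`).

> "(iii) Suppose that `φ` is irreducible. Then `φ` is a non-pre-step if and only if the
> following condition holds: There exists an `N ∈ N_{≥1}` such that for every equality of
> composites in `C` `αₙ ∘ αₙ₋₁ ∘ … ∘ α₂ ∘ α₁ = ψ ∘ φ` — where `α₁, …, αₙ, ψ` are FSMI-morphisms
> [cf. §0] — it holds that `n ≤ N`."

PROVED here: the implication "`φ` an irreducible NON-pre-step ⟹ the condition holds" (with
`N = N_D + 3`, `N_D` the bound of condition (b) of "FSMFF-type" for chains out of `A_D`), along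
the printed proof (pp. 42–43): by (i) every FSMI-morphism of `C` is (a) prime-Frobenius,
(b) a step with irreducible zero divisor, or (c) a pull-back morphism with FSMI projection; in a
chain `αₙ ∘ ⋯ ∘ α₁ = ψ ∘ φ` the Frobenius degree (dividing a product of two primes) bounds the
number of (a)-factors by `2`, the zero divisor (zero or irreducible, `φ` being an isometry with
bijective `φ^*`) bounds the number of (b)-factors by `1`, and the (c)-factors project to an
FSMI-chain of `D` out of `A_D` [Prop. 1.11 (vi)], of length `≤ N_D`.

ERRATUM recorded (reported to the cell's L1 lead and referee, 2026-08-25): the converse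
implication printed in (iii) ("`φ` an irreducible pre-step ⟹ the condition fails", argued on p. 42
"by taking `ψ` to be a prime-Frobenius morphism of increasingly large Frobenius degree") presumes
that prime-Frobenius morphisms are FSMI-morphisms; they need not be fiberwise-surjective (in the
standard Frobenioid `F_{ℤ_{≥0}}` of Def. 1.1 (iii), `ψ = (0, p)` and `γ = (1, p)` admit no
`δ`'s with `ψ ∘ δ = γ ∘ δ′`, as `p x = 1 + p y` has no solution), and for the step `φ = (1, 1)` of
the standard Frobenioid the condition holds with `N = 2`. The printed biconditional is therefore
kept only as the named statement `NonPreStepIffBoundedFSMIChains` (FALSE AS TYPED, not asserted) in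
`IrreducibleMorphismsCounterexample.lean`, next to its kernel-checked negation; the present file
proves its true half. The AUTHOR HAS SINCE REPLACED the statement (and condition (b) of "FSMFF-type"
in §0): *Comments on "The geometry of Frobenioids I"* (January 2024), item (28) — `α₁` and `ψ`
irreducible instead of FSMI, under the guard "if `φ` is an FSM-morphism"; the revised statement is
typed and PROVED in `IrreducibleMorphismsRevised.lean` over `CategoriesFactorizationRevised.lean`
[cite: MochizukiFrdIComments2024, (28) pp.3-4].

Renderings: "`αₙ ∘ … ∘ α₁ = ψ ∘ φ` with `αᵢ` FSMI" is `IsFSMIChain (φ ≫ ψ) n`; `Ω` is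
`ArithmeticFunction.cardFactors` (number of prime factors with multiplicity).
-/

namespace Literature.AlgebraicGeometry.Frobenioids

open CategoryTheory Opposite ArithmeticFunction

universe w v v' u u'

/-! ### Monoid bookkeeping -/

section Monoid

variable {M N : Type w} [CommMonoid M] [CommMonoid N]

/-- Irreducibility of elements (FrdI §0 p. 12) is invariant under bijective homomorphisms.
[cite: MochizukiFrdI2008, §0 p.12] -/
theorem isIrreducibleElt_map_iff (f : M →* N) (hf : Function.Bijective f) (a : M) :
    IsIrreducibleElt (f a) ↔ IsIrreducibleElt a := by
  have h1 : ∀ x, f x = 1 ↔ x = 1 := fun x => map_eq_one_iff f hf.1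
  constructor
  · rintro ⟨hne, hfac⟩
    refine ⟨fun h => hne ((h1 a).mpr h), fun b c h => ?_⟩
    rcases hfac (f b) (f c) (by rw [← map_mul, h]) with hb | hc
    · exact Or.inl ((h1 b).mp hb)
    · exact Or.inr ((h1 c).mp hc)
  · rintro ⟨hne, hfac⟩
    refine ⟨fun h => hne ((h1 a).mp h), fun b' c' h => ?_⟩
    obtain ⟨b, rfl⟩ := hf.2 b'
    obtain ⟨c, rfl⟩ := hf.2 c'
    rcases hfac b c (hf.1 (by rw [map_mul, h])) with hb | hc
    · exact Or.inl (by rw [hb, map_one])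
    · exact Or.inr (by rw [hc, map_one])

end Monoid

namespace PreFrobenioid

variable {D : Type u} [Category.{v} D] {Φ : Dᵒᵖ ⥤ CommMonCat.{w}}
  {C : Type u'} [Category.{v'} C] (F : C ⥤ ElemFrobenioid Φ)

/-! ### The three kinds of FSMI-morphisms [(i) and Prop. 1.11 (vi)] -/

/-- An FSMI-morphism of a Frobenioid of isotropic type is (a) prime-Frobenius, (b) a step with
irreducible zero divisor, or (c) a pull-back morphism whose projection to `D` is an
FSMI-morphism [(i); Prop. 1.11 (vi)]. [cite: MochizukiFrdI2008, Prop. 1.14(iii) p.43] -/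
theorem fsmi_trichotomy (hF : IsFrobenioid F) (hist : IsOfIsotropicType F) {X Y : C} {α : X ⟶ Y}
    (hα : IsFSMI α) :
    IsPrimeFrobenius F α ∨ (IsStep F α ∧ IsIrreducibleElt (Div F α)) ∨
      (IsPullbackMorphism F α ∧ IsFSMI (Base F α)) := by
  rcases trichotomy_of_isIrreducibleHom F hF hist hα.2 with ha | hb | ⟨hc, hcirr⟩
  · exact Or.inl ha
  · exact Or.inr (Or.inl hb)
  · exact Or.inr (Or.inr ⟨hc, (isFSM_iff_of_isPullbackMorphism hF hc).mp hα.1, hcirr⟩)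

/-! ### The counting invariant of a chain of FSMI-morphisms -/

/-- The invariant behind the proof of Prop. 1.14 (iii) (p. 43): a composite `χ` of `n`
FSMI-morphisms of `C` has `n = m + Ω(deg_Fr(χ)) + k`, where `Base(χ)` is an isomorphism (`m = 0`)
or a composite of `m` FSMI-morphisms of `D`, and `k` (the number of steps among the factors)
satisfies: `k = 0 ⟹ Div(χ) = 0`, `k ≥ 1 ⟹ Div(χ) ≠ 0`, `k ≥ 2 ⟹ Div(χ)` is not irreducible.
[cite: MochizukiFrdI2008, Prop. 1.14(iii) p.43] -/
theorem chain_invariant (hF : IsFrobenioid F) (hist : IsOfIsotropicType F) {X B' : C} {χ : X ⟶ B'}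
    {n : ℕ} (h : IsFSMIChain χ n) :
    ∃ m k : ℕ, n = m + cardFactors (degFr F χ : ℕ) + k ∧
      ((m = 0 ∧ IsIso (Base F χ)) ∨ IsFSMIChain (Base F χ) m) ∧
      (k = 0 → Div F χ = 1) ∧ (0 < k → Div F χ ≠ 1) ∧ (1 < k → ¬ IsIrreducibleElt (Div F χ)) := by
  have hP : IsPreFrobenioid Φ F := hF.isPreFrobenioid
  induction h with
  | single α hα =>
    rcases fsmi_trichotomy F hF hist hα with ha | ⟨hb, hbirr⟩ | ⟨hc, hcb⟩
    · haveI : IsIso (Base F α) := ha.1.2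
      refine ⟨0, 0, ?_, Or.inl ⟨rfl, inferInstance⟩, fun _ => ha.1.1.2,
        fun h => (lt_irrefl 0 h).elim, fun h => by omega⟩
      rw [cardFactors_apply_prime ha.2]
    · haveI : IsIso (Base F α) := hb.1.2
      refine ⟨0, 1, ?_, Or.inl ⟨rfl, inferInstance⟩, fun h => by omega, fun _ => hbirr.1,
        fun h => by omega⟩
      rw [show degFr F α = 1 from hb.1.1, PNat.one_coe, cardFactors_one]
    · refine ⟨1, 0, ?_, Or.inr (IsFSMIChain.single _ hcb), fun _ => (hF.iv_b α hc).1.2,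
        fun h => (lt_irrefl 0 h).elim, fun h => by omega⟩
      rw [show degFr F α = 1 from (hF.iv_b α hc).2, PNat.one_coe, cardFactors_one]
  | cons α χ' n' hα _ ih =>
    obtain ⟨m', k', hn', hbase', h0', h1', h2'⟩ := ih
    have hinj : Function.Injective (pull Φ (Base F α)) := (hP.isMonoidOn.isCharInjective _).1
    have hdeg : (degFr F (α ≫ χ') : ℕ) = degFr F α * degFr F χ' := by
      rw [degFr_comp, PNat.mul_coe]
    have hdiv : Div F (α ≫ χ') = pull Φ (Base F α) (Div F χ') * Div F α ^ (degFr F χ' : ℕ) :=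
      div_comp F α χ'
    -- the common part of cases (a) and (c): `Div(χ' ∘ α) = α^* Div(χ')` with `α^*` bijective
    have transport : ∀ (hbij : Function.Bijective (pull Φ (Base F α)))
        (hdiv' : Div F (α ≫ χ') = pull Φ (Base F α) (Div F χ')),
        (k' = 0 → Div F (α ≫ χ') = 1) ∧ (0 < k' → Div F (α ≫ χ') ≠ 1) ∧
          (1 < k' → ¬ IsIrreducibleElt (Div F (α ≫ χ'))) := fun hbij hdiv' =>
      ⟨fun hk => by rw [hdiv', h0' hk, map_one],
        fun hk h1 => h1' hk ((map_eq_one_iff _ hbij.1).mp (hdiv' ▸ h1)),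
        fun hk hirr => h2' hk ((isIrreducibleElt_map_iff _ hbij _).mp (hdiv' ▸ hirr))⟩
    -- absorbing a base-isomorphism into the chain of `D`
    have absorb : IsIso (Base F α) →
        ((m' = 0 ∧ IsIso (Base F (α ≫ χ'))) ∨ IsFSMIChain (Base F (α ≫ χ')) m') := fun hiso => by
      rcases hbase' with ⟨hm0, hiso'⟩ | hch
      · left
        refine ⟨hm0, ?_⟩
        rw [base_comp]
        infer_instance
      · right
        rw [base_comp]
        exact hch.iso_comp (asIso (Base F α))
    rcases fsmi_trichotomy F hF hist hα with ha | ⟨hb, hbirr⟩ | ⟨hc, hcb⟩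
    · -- (a): base-isomorphism, isometry, prime degree
      haveI : IsIso (Base F α) := ha.1.2
      have hΩ : cardFactors (degFr F (α ≫ χ') : ℕ) = cardFactors (degFr F χ' : ℕ) + 1 := by
        rw [hdeg, cardFactors_mul (PNat.ne_zero _) (PNat.ne_zero _),
          cardFactors_apply_prime ha.2, add_comm]
      have hdiv' : Div F (α ≫ χ') = pull Φ (Base F α) (Div F χ') := by
        rw [hdiv, show Div F α = 1 from ha.1.1.2, one_pow, mul_one]
      obtain ⟨t0, t1, t2⟩ := transport ⟨pull_injective_of_isIso Φ (Base F α),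
        fun y => ⟨pull Φ (inv (Base F α)) y, pull_pull_inv Φ (Base F α) y⟩⟩ hdiv'
      exact ⟨m', k', by rw [hΩ]; omega, absorb inferInstance, t0, t1, t2⟩
    · -- (b): base-isomorphism, linear, irreducible (nonzero) zero divisor
      haveI : IsIso (Base F α) := hb.1.2
      have hΩ : cardFactors (degFr F (α ≫ χ') : ℕ) = cardFactors (degFr F χ' : ℕ) := by
        rw [hdeg, show degFr F α = 1 from hb.1.1, PNat.one_coe, one_mul]
      have ht : Div F α ^ (degFr F χ' : ℕ) ≠ 1 := fun h =>
        hbirr.1 ((hP.isDivisorial _).isSharp.isTorsionFree.eq_one_of_pow_eq_one _ _ (PNat.pos _) h)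
      refine ⟨m', k' + 1, by rw [hΩ]; omega, absorb inferInstance, fun h => by omega,
        fun _ h1 => ?_, fun hk hirr => ?_⟩
      · rw [hdiv] at h1
        exact ht ((hP.isDivisorial _).isSharp.eq_one_of_isUnit _ (IsUnit.of_mul_eq_one_right _ h1))
      · have hu : pull Φ (Base F α) (Div F χ') ≠ 1 := fun h =>
          h1' (by omega) ((map_eq_one_iff _ hinj).mp h)
        rcases hirr.2 _ _ hdiv with h | h
        · exact hu h
        · exact ht h
    · -- (c): pull-back morphism with FSMI projection; linear isometry, `α^*` bijective
      have hbij := hP.isMonoidOn.bijective_of_isFSM (Base F α) hcb.1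
      have hΩ : cardFactors (degFr F (α ≫ χ') : ℕ) = cardFactors (degFr F χ' : ℕ) := by
        rw [hdeg, show degFr F α = 1 from (hF.iv_b α hc).2, PNat.one_coe, one_mul]
      have hdiv' : Div F (α ≫ χ') = pull Φ (Base F α) (Div F χ') := by
        rw [hdiv, show Div F α = 1 from (hF.iv_b α hc).1.2, one_pow, mul_one]
      obtain ⟨t0, t1, t2⟩ := transport hbij hdiv'
      refine ⟨m' + 1, k', by rw [hΩ]; omega, Or.inr ?_, t0, t1, t2⟩
      rw [base_comp]
      rcases hbase' with ⟨hm0, hiso'⟩ | hch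
      · subst hm0
        haveI := hiso'
        exact IsFSMIChain.single _ (hcb.comp_iso (asIso (Base F χ')))
      · exact IsFSMIChain.cons _ _ _ hcb hch

/-! ### Proposition 1.14 (iii), the implication "non-pre-step ⟹ bounded chains" -/

/-- **Prop. 1.14 (iii)**, "⟹": in a Frobenioid of isotropic type over a base category of
FSMFF-type, if `φ : A → B` is an irreducible morphism which is NOT a pre-step, then there is an
`N` such that every equality `αₙ ∘ ⋯ ∘ α₁ = ψ ∘ φ` with `α₁, …, αₙ, ψ` FSMI-morphisms has `n ≤ N`
(see the module docstring for the status of the printed converse).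
[cite: MochizukiFrdI2008, Prop. 1.14(iii) p.41] -/
theorem exists_chain_bound_of_not_isPreStep (hF : IsFrobenioid F) (hist : IsOfIsotropicType F)
    (hD : IsOfFSMFFType D) {A B : C} {φ : A ⟶ B} (hirr : IsIrreducibleHom φ)
    (hnps : ¬ IsPreStep F φ) :
    ∃ N : ℕ, ∀ ⦃B' : C⦄ (ψ : B ⟶ B') (n : ℕ), IsFSMI ψ → IsFSMIChain (φ ≫ ψ) n → n ≤ N := by
  have hP : IsPreFrobenioid Φ F := hF.isPreFrobenioid
  obtain ⟨N, hN⟩ := hD.bounded (baseObj F A)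
  refine ⟨N + 3, fun B' ψ n hψ hch => ?_⟩
  obtain ⟨m, k, hn, hbase, -, h1, h2⟩ := chain_invariant F hF hist hch
  -- the chain of `D` has length `≤ N`
  have hm : m ≤ N := by
    rcases hbase with ⟨hm0, -⟩ | hc
    · omega
    · exact hN _ m hc
  -- `φ` is prime-Frobenius or a pull-back morphism [(i)]; `deg(ψ ∘ φ)` has at most two prime factors
  have hφ : IsPrimeFrobenius F φ ∨ IsPullbackMorphism F φ := by
    rcases trichotomy_of_isIrreducibleHom F hF hist hirr with ha | ⟨hb, -⟩ | ⟨hc, -⟩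
    · exact Or.inl ha
    · exact (hnps hb.1).elim
    · exact Or.inr hc
  have hΩφ : cardFactors (degFr F φ : ℕ) ≤ 1 := by
    rcases hφ with ha | hc
    · rw [cardFactors_apply_prime ha.2]
    · rw [show degFr F φ = 1 from (hF.iv_b φ hc).2, PNat.one_coe, cardFactors_one]
      exact Nat.zero_le _
  have hΩψ : cardFactors (degFr F ψ : ℕ) ≤ 1 := by
    rcases fsmi_trichotomy F hF hist hψ with ha | ⟨hb, -⟩ | ⟨hc, -⟩
    · rw [cardFactors_apply_prime ha.2]
    · rw [show degFr F ψ = 1 from hb.1.1, PNat.one_coe, cardFactors_one]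
      exact Nat.zero_le _
    · rw [show degFr F ψ = 1 from (hF.iv_b ψ hc).2, PNat.one_coe, cardFactors_one]
      exact Nat.zero_le _
  have hΩ : cardFactors (degFr F (φ ≫ ψ) : ℕ) ≤ 2 := by
    rw [degFr_comp, PNat.mul_coe, cardFactors_mul (PNat.ne_zero _) (PNat.ne_zero _)]
    omega
  -- `Div(ψ ∘ φ) = φ^* Div(ψ)` is zero or irreducible, so `k ≤ 1`
  have hk : k ≤ 1 := by
    by_contra hk
    have hne : Div F (φ ≫ ψ) ≠ 1 := h1 (by omega)
    have hnirr : ¬ IsIrreducibleElt (Div F (φ ≫ ψ)) := h2 (by omega)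
    have hφi : IsIsometry F φ := hφ.elim (fun ha => ha.1.1.2) (fun hc => (hF.iv_b φ hc).1.2)
    have hd : Div F (φ ≫ ψ) = pull Φ (Base F φ) (Div F ψ) := by
      rw [div_comp, show Div F φ = 1 from hφi, one_pow, mul_one]
    have hbij : Function.Bijective (pull Φ (Base F φ)) := by
      rcases hφ with ha | hc
      · haveI : IsIso (Base F φ) := ha.1.2
        exact ⟨pull_injective_of_isIso Φ (Base F φ),
          fun y => ⟨pull Φ (inv (Base F φ)) y, pull_pull_inv Φ (Base F φ) y⟩⟩
      · haveI := hψ.1.2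
        have hφfsm : IsFSM φ := IsFSM.of_comp_mono hch.isFSM
        exact hP.isMonoidOn.bijective_of_isFSM _
          ((isFSM_iff_of_isPullbackMorphism hF hc).mp hφfsm)
    rcases fsmi_trichotomy F hF hist hψ with ha | ⟨hb, hbirr⟩ | ⟨hc, -⟩
    · exact hne (by rw [hd, show Div F ψ = 1 from ha.1.1.2, map_one])
    · exact hnirr (by rw [hd]; exact (isIrreducibleElt_map_iff _ hbij _).mpr hbirr)
    · exact hne (by rw [hd, show Div F ψ = 1 from (hF.iv_b ψ hc).1.2, map_one])
  omega

end PreFrobenioid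

end Literature.AlgebraicGeometry.Frobenioids
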